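import Summits.SmoothPoincare4.SmoothPoincare4.Theses.ConvexBisection
import Summits.SmoothPoincare4.SmoothPoincare4.Theorems.ConvexBisectionContractibleTwistedDoubleStandardClosedOneZeroOne
import Summits.SmoothPoincare4.SmoothPoincare4.Theorems.ConvexBisectionContractibleTwistedDoubleStandardBisectionOrientable
import Summits.SmoothPoincare4.SmoothPoincare4.Theorems.ConvexBisectionContractibleTwistedDoubleStandardMazurGluedProfile
import Summits.SmoothPoincare4.SmoothPoincare4.Theorems.ConvexBisectionContractibleTwistedDoubleStandardHomotopySphere
import Summits.SmoothPoincare4.SmoothPoincare4.Theorems.ContractibleTwistedDoubleStandard.Negative.LoadBearing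
import Summits.SmoothPoincare4.SmoothPoincare4.Theorems.ConvexBisectionSphereSeamStandard
import Literature.Topology.FourManifolds.SPC4HandlesImpliesCerf
import Literature.Topology.FourManifolds.BallGluingUniqueness
import Literature.Topology.FourManifolds.Handles
import Literature.Topology.FourManifolds.Gluing
import Literature.Topology.FourManifolds.SmoothOrientation
import Literature.Geometry.Symplectic.SteinOrientation
import Literature.Geometry.Symplectic.SteinBoundaryContactProofs
import Literature.Geometry.Symplectic.SteinFillingSphere
import Literature.Topology.FourManifolds.PropertyRTraceClosing
import HarnessLib.Audit

/-!
# Line `property-r-mazur-halves` — skeleton m12b (= m12 with the landed `stub_homotopySphere` p112822 IMPORTED; m12 = m11 with THE BET identified as the open core of the EXISTING crux item stmt-SmoothPoincare4-0435 `GroupTrisection.GtriMorse1121` and derived from it; "glued Morse functions; simply connected seams via Perelman–Eliashberg–Cerf; the bet over homotopy 4-spheres")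
for crux `ConvexBisection.ContractibleTwistedDoubleStandard` (stmt-SmoothPoincare4-3546), idea card
`Cruxes/ContractibleTwistedDoubleStandard/Ideas/property-r-mazur-halves.md`.

Crux (fixed, never restated): a closed smooth 4-manifold `X` which is a Stein bisection along a
common contact seam of two compact CONTRACTIBLE Stein domains `(W₁,J₁)`, `(W₂,J₂)` is `S⁴`.

The line, m10 form (= m9 with the homotopy-sphere lemma PROVED and the bet restated over homotopy
`4`-spheres) — three sectors.
* SIMPLY CONNECTED SEAM (`SimplyConnectedSpace (∂W₁)`; contains every bisection with a ball half):
  the abstract boundary of `W₁` is a closed simply connected `3`-manifold, hence `≅ S³` by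
  Perelman (named fact P = `nonempty_diffeomorph_sphere_three`), so both halves are Stein fillings
  of `S³`, hence `𝔻⁴` by Eliashberg (named fact E), and the twisted sphere `𝔻⁴ ∪_χ 𝔻⁴` is `S⁴` by
  Cerf (C ⇐ LP, a tree theorem) — the landed route theorem
  `Theorems.nonempty_diffeomorph_sphere_four_of_steinBisection_of_diffeomorph`
  (`ConvexBisectionSphereSeamStandard.lean`).  NEW as a sector of this line in m9 (m8 had the
  smaller "some half is smoothly a ball", m6/m7 the still smaller "ball × small").
* MAZUR × MAZUR (both halves carry adapted Morse functions with indices `≤ 2` and exactly one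
  critical point of each index `0, 1, 2`): the functions glue across the seam to a `(1,1,2,1,1)`
  Morse function on `X` (`stub_mazurGluedProfile`, LANDED p110167), THE BET
  `stub_mazurSectorCancellation` (a crux `X` with a `(1,1,2,1,1)` Morse function has a
  `(1,0,1,1,1)` one — the `1`-handle cancels; open, SPC4-class) and `stub_bisectionOrientable`
  (LANDED p108569) feed `stub_closedOneZeroOne` (LANDED p108247; Milnor's rearrangement, level
  splitting, Property R, Laudenbach–Poénaru; named facts LP, R).
* THE RESIDUAL `stub_nonSmallSector` (m9 form): the seam is NOT simply connected (a homology
  `3`-sphere with non-trivial perfect `π₁`) and the halves are NOT both smoothly Mazur.  Strictly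
  smaller than m8's residual; crux-sized (through `ψ = id` it contains the doubles of every
  contractible Stein `2`-handlebody with `≥ 2` one-handles and non-simply-connected boundary, i.e.
  the open core of stmt-SmoothPoincare4-3717 / 4786; `StrictPropertyTwoRBarrier` bites).

## Reshape m12b (mechanical): `stub_homotopySphere` (LANDED p112822) is IMPORTED and used by its landed name; registered sorries 6 → 5:
`stub_factPropertyRClosingPair` (LP+R) · `stub_factEliashberg` (E) · `stub_factPerelman` (P) · `stub_gtriMorse1121` (= item 0435) ·
`stub_nonSmallSector` (residual).  Nothing provable is left in the skeleton.

## Reshape m12 (lead prover-line-stmt-SmoothPoincare4-3546-c7-0, eighth lead, 2026-08-16)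

m11 → m12: THE BET is no longer a free-standing registered stub.  It is the `(c₁, c₃) = (1, 1)` case of
the EXISTING open crux item stmt-SmoothPoincare4-0435 of route `GroupTrisection`,
`Summit.SmoothPoincare4.SmoothPoincare4.Theses.GroupTrisection.GtriMorse1121` ("a closed smooth `M ≃ₕ S⁴`
with a Morse function having one minimum, `≤ 1` critical point of index `1`, `≤ 1` of index `3` and one
maximum is diffeomorphic to `S⁴`"; its other cases `(0,0), (1,0), (0,1)` are Reeb–Cerf and Property R).
NEW registered stub `stub_gtriMorse1121` = that item's signature VERBATIM (`Iff.rfl` with the route decl,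
checked in `work/scratch_gtri.lean`, rc 0); the bet `stub_homotopySphereOneOneTwoOneOne` keeps its name and
statement but is now PROVED in the skeleton from `stub_gtriMorse1121` and the landed tightness lemma
`oneZeroOneOneOne_of_nonempty_diffeomorph_sphere` (p108569).  So the planners need NOT file the bet as a new
conjecture item (memos v6–v10): it is served by stmt-SmoothPoincare4-0435, and this sector closes by `exact`
the day that item is proved.  Registered sorries (6, as m11; 5 once p112822's module is in the build
snapshot): `stub_factPropertyRClosingPair` (LP+R) · `stub_factEliashberg` (E) · `stub_factPerelman` (P) ·
`stub_homotopySphere` (LANDED p112822, sorry copy until built) · `stub_gtriMorse1121` (= item 0435, open) ·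
`stub_nonSmallSector` (residual, crux-sized).  Crux CLOSED MODULO {P, E, LP, R} ∪ {stmt-0435, residual}.
Trisection reading of the bet / of 0435's open case (c7 literature pass): homotopy `4`-spheres with a
`(g; 1, g-2, 1)`-trisection; `g = 2` is Meier–Schirmer–Zupan 2016 Thm 1.2, `g = 3` is the balanced
`(3;1,1,1)` = items stmt-SmoothPoincare4-0505/0507 of the same route (Aranda–Zupan arXiv:2503.04607 settle the
weakly reducible ones), `g ≥ 4` open below SPC4 — see the docstring of `stub_gtriMorse1121`.

## Reshape m11 (lead prover-line-stmt-SmoothPoincare4-3546-c6-0, seventh lead, 2026-08-16)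

m10 → m11: no statement changed.  The three landed stubs whose modules the farm snapshot now builds are
IMPORTED instead of carried as `sorry` copies and are used BY THEIR LANDED NAMES in the composition:
`…Theorems.ContractibleTwistedDoubleStandard.PropertyRMazurHalves.stub_closedOneZeroOne` (p108247, module
`…Theorems.ConvexBisectionContractibleTwistedDoubleStandardClosedOneZeroOne`), `….stub_bisectionOrientable`
(p108569, `…BisectionOrientable`), `….stub_mazurGluedProfile` (p110167, `…MazurGluedProfile`).  Registered
sorries 9 → 6: `stub_factPropertyRClosingPair` (LP+R) · `stub_factEliashberg` (E) · `stub_factPerelman` (P) ·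
`stub_homotopySphere` (LANDED p112822; `sorry` copy only until the snapshot builds its module, then → 5) ·
`stub_homotopySphereOneOneTwoOneOne` (THE BET) · `stub_nonSmallSector` (residual).

## Reshape m10 (lead prover-line-stmt-SmoothPoincare4-3546-c5-0, sixth lead, 2026-08-16)

m9 → m10: (i) NEW stub `stub_homotopySphere` — every crux bisection `X` is a homotopy `4`-sphere
(`X ≃ₕ S⁴`) — PROVED (`work/HomotopySphere.lean`, rc 0, 0 sorry: seam diffeomorphism of `stub_seam`,
collar, `BoundaryCollar.GluingData`, van Kampen, a two-piece Mayer–Vietoris `H₂(X) ≅ H₁(∂W₂) = 0`,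
Alexander duality, Freedman–Quinn recognition; the lemma the Disproof v9 lists as "not formalisable
here"), to be landed as `Theorems/ConvexBisectionContractibleTwistedDoubleStandardHomotopySphere.lean`;
(ii) THE BET is restated over homotopy `4`-spheres (`stub_homotopySphereOneOneTwoOneOne`): a closed
smooth `X ≃ₕ S⁴` with a `(1,1,2,1,1)` Morse function has a `(1,0,1,1,1)` one.  It drops the crux data
the m9 bet carried but no lead could use (five leads: no lever in print constrains `W₁ ∪_ψ W̄₂` through
the contactomorphism `ψ`; filling-uniqueness / Lagrangian-disc / CET levers are refuted by Hayden
arXiv:2003.13681 Thm 1.3 and the exotic Mazur pairs of Hayden–Mark–Piccirillo arXiv:1908.05269), and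
keeps exactly what the smooth argument consumes; the composition feeds it `stub_homotopySphere`.
Smooth content, three equivalent readings: SPC4 for homotopy `4`-spheres of handle profile
`(1,1,2,1,1)`; every twisted double `W₁ ∪_ψ W̄₂` of two Mazur-type (one `0`-, `1`-, `2`-handle)
contractible `4`-manifolds along ANY boundary diffeomorphism is `S⁴` (slide to windings `(1,0)`,
split at the middle level); every simply connected `N = S¹×B³ ∪ h₁ ∪ h₂` with `∂N ≅ S¹×S²` is
`S²×D²`.  Open (no engine in print; Nersisyan arXiv:2606.24220 §7, p. 24, cannot standardise even
the ribbon-cobordism variants `M ∪ W_R ∪ −M′`); known instances `ψ = id` (Mazur 1961) and the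
zero-dot exchanges inside `S⁴` (Akbulut 1991; Nersisyan §1.2).  The 3-dimensional side carries no
rigidity: for `γ = ψ⁻¹(belt circle) ⊂ Y = ∂W₁` (a knot with an `S¹×S²` surgery) Gabai's
norm-minimising dichotomy lands in its `S¹×S²` branch symmetrically in `K₁`, `K₂`.
(iii) The residual `stub_nonSmallSector`, the fact-stubs and the three LANDED stubs are byte-identical
to m9 (the landed ones stay `sorry` copies until the farm snapshot builds their modules).

## Reshape m9 (lead prover-line-stmt-SmoothPoincare4-3546-c4-0, 2026-08-16; m8 → m9 same session)

m8 → m9: the two ball sectors (m8: `stub_ballHalfSmooth` p96608 for ball × anything, `stub_ballSectorMorse`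
p108299 + `stub_closedOneZeroOne` for ball × small) are SUBSUMED by the simply-connected-seam sector, closed
by the landed route theorem for `SphereSeamStandard` modulo P + E + Cerf; the residual's hypotheses
`¬ ball W₁`, `¬ ball W₂` become the single, stronger `¬ SimplyConnectedSpace (∂W₁)`.  New fact-stub
`stub_factPerelman`.  `stub_ballSectorMorse` (p108299) and `stub_ballHalfSmooth` (p96608) leave the
composition (they remain landed theorems: the E-free / P-free closings of their sub-sectors).
m7 → m8 (same lead): landed stubs imported, Eliashberg ball sector restored, `stub_mazurGluedProfile`
factored out of the bet (LANDED p110167), bet restated on the closed manifold.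

Registered stubs (m10; m11 imports the three marked LANDED p108247/p108569/p110167 instead; m12 replaces the bet by `stub_gtriMorse1121` = item 0435 and derives the bet): `stub_factPropertyRClosingPair` (LP+R, fact seats) · `stub_factEliashberg` (E) ·
`stub_factPerelman` (P) · `stub_closedOneZeroOne` (LANDED p108247) · `stub_bisectionOrientable` (LANDED
p108569) · `stub_mazurGluedProfile` (LANDED p110167) · `stub_homotopySphere` (LANDED p112822) ·
`stub_homotopySphereOneOneTwoOneOne` (THE BET, m10 form, open) · `stub_nonSmallSector` (residual, m9 form,
open).  The LANDED/PROVED stubs are carried as `sorry` copies only until the farm snapshot builds their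
modules.  So the crux is CLOSED MODULO {P, E, LP, R} (published theorems: Perelman, Eliashberg 1990,
Laudenbach–Poénaru ⊇ Cerf, Property R ⊇ Gabai) ∪ {bet, residual} (open).

Disproof / Negative lemmas honoured (`…Negative.LoadBearing`, `…Negative.DoubleBisection`,
`Cruxes/…/Disproof.lean` v9): every stub concluding `X ≅ S⁴` or the bet keeps CONTRACTIBILITY of both
halves and the COVER/gluing condition (`not_crux_without_contractible`, `not_crux_without_cover`);
no stub is a filling-uniqueness / chirality lever (Hayden's exotic contractible Stein pairs `X_H`,
arXiv:2003.13681 Thm 1.3, sit inside the bet's sector as honest test cases); `double_standard_of_crux`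
(`ψ = id`) lands inside `stub_nonSmallSector` for `≥ 2` one-handles and inside the bet for Mazur
doubles (Mazur 1961, true there).
-/

noncomputable section

set_option linter.dupNamespace false

open scoped Manifold ContDiff Topology ContinuousMap
open Set Function Literature.Topology.FourManifolds Literature.Geometry.Symplectic

namespace Summit.SmoothPoincare4.SmoothPoincare4.Cruxes.ContractibleTwistedDoubleStandard.PropertyRMazurHalves

open Summit.SmoothPoincare4.SmoothPoincare4.Theorems.ContractibleTwistedDoubleStandard in
/-- **Fact-stub LP+R (NAMED-FACT DEBT, two published theorems bundled):**
(LP) Laudenbach–Poénaru 1972 — a diffeomorphism of `#ᵏ S¹ × S²` extends over the `1`-handlebody: VERBATIM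
`Literature.Topology.FourManifolds.exists_diffeomorph_comp_incl_eq` (`SPC4Handles.lean` (c)) at universe `0`
(its `k = 0` case is Cerf's `Γ₄ = 0`, `cerf_diffeomorph_sphere_three_extends_ball_of_exists_diffeomorph_comp_incl_eq`);
(R) the Property R half of Gompf–Scharlemann–Thompson 2010 Prop. 9.2 for ONE `2`-handle: VERBATIM
`Literature.Topology.FourManifolds.propertyR_exists_isBoundaryGluing_sphere_four` (`PropertyRTraceClosing.lean`,
reduced THERE to Gabai 1987 Cor. 8.3 and clause (ii) of `exists_framedKnot_of_hasHandleDecomposition_oneZeroOne`).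
Discharge = `⟨LP_holds, R_holds⟩` (Literature fact seats).  `stub_closedOneZeroOne` (LANDED p108247) is
conditional on exactly these two; `stub_ballHalfSmooth` (LANDED p96608) needs LP (for Cerf) and E. -/
theorem stub_factPropertyRClosingPair :
    exists_diffeomorph_comp_incl_eq.{0} ∧ propertyR_exists_isBoundaryGluing_sphere_four := by
  sorry

/-- **Fact-stub E (NAMED-FACT DEBT, one published theorem):** Eliashberg 1990 Thm. 5.1 (with Eliashberg
1992 Thm. 2.1.1): a compact Stein domain bounded by `S³` is diffeomorphic to `𝔻⁴` — VERBATIM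
`Literature.Geometry.Symplectic.Eliashberg1990_steinFilling_sphere_three` (`SteinFillingSphere.lean`).  Used
only on the simply-connected-seam sector, through the landed
`Theorems.nonempty_diffeomorph_sphere_four_of_steinBisection_of_diffeomorph`.  Discharge = `E_holds`
(Literature fact seat). [cite: Eliashberg1990, Thm. 5.1] -/
theorem stub_factEliashberg : Eliashberg1990_steinFilling_sphere_three := by
  sorry

/-- **Fact-stub P (NAMED-FACT DEBT, one published theorem; NEW in m9):** Perelman 2002–03 (Morgan–Tian
2007, Cor. 0.2 (a)): a closed, simply connected, smooth `3`-manifold is diffeomorphic to `S³` — VERBATIM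
`Literature.Topology.FourManifolds.nonempty_diffeomorph_sphere_three` (`SPC4Wave0.lean`) at universe `0`.
Used only on the simply-connected-seam sector (it turns `π₁(∂W₁) = 1` into a diffeomorphism
`∂W₁ ≅ S³`, the hypothesis of Eliashberg's theorem).  Discharge = `P_holds` (Literature fact seat).
[cite: MorganTian2007, Cor. 0.2 (a)] -/
theorem stub_factPerelman : nonempty_diffeomorph_sphere_three.{0} := by
  sorry

-- Stub H `stub_homotopySphere` (every crux bisection `X` is a homotopy `4`-sphere; NEW in m10, LANDED p112822 as
-- `…Theorems.ContractibleTwistedDoubleStandard.PropertyRMazurHalves.stub_homotopySphere`, module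
-- `…Theorems.ConvexBisectionContractibleTwistedDoubleStandardHomotopySphere`) is IMPORTED since m12b and used by name below.

/-- **Stub G (`stub_gtriMorse1121`, NEW in m12 — THE SHARED BET; XL, open; SPC4-class).**  VERBATIM the
signature of the EXISTING open crux item stmt-SmoothPoincare4-0435 of route `GroupTrisection`,
`Summit.SmoothPoincare4.SmoothPoincare4.Theses.GroupTrisection.GtriMorse1121` (`Iff.rfl` with that decl, checked
in the lead's `work/scratch_gtri.lean`): a closed smooth `M ≃ₕ S⁴` carrying a Morse function with exactly one
minimum, at most one critical point of index `1`, at most one of index `3` and exactly one maximum is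
diffeomorphic to `S⁴`.  By `χ = 2` the number of index-`2` points is `c₁ + c₃ ≤ 2`; the cases
`(c₁,c₃) = (0,0)` (two or no middle critical points: twisted sphere, Reeb + Cerf), `(0,1)` and `(1,0)`
(profile `(1,0,1,1,1)` and its upside-down: Property R + Laudenbach–Poénaru, the landed `stub_closedOneZeroOne`)
are theorems; the case `(1,1)` — profile `(1,1,2,1,1)` — is EXACTLY this line's bet (below, now derived from
this stub), i.e. SPC4 for twisted doubles `W₁ ∪_ψ W̄₂` of two Mazur-type contractible `4`-manifolds, i.e.
every simply connected `N = S¹ × B³ ∪ h₁ ∪ h₂` with `∂N ≅ S¹ × S²` is `S² × D²`, i.e. the homotopy-sphere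
case of the surgery problem "`2`-component framed links in `S¹ × S²` with an `S¹ × S²` surgery"
(`k = k' = 1, n = 2` in Meier–Zupan arXiv:1707.08955 §1).  TRISECTION FORM AND EXACT FRONTIER (lead c7): by
the Heegaard–Kirby dictionary (Gay–Kirby 2016 Lemma 14 = Meier–Schirmer–Zupan arXiv:1507.06561 Prop. 4.2 /
Lemma 4.6) a closed `X` has a `(1,1,2,1,1)` handle decomposition iff it admits a `(g; 1, g-2, 1)`-trisection
for some `g ≥ 2` (`g = t(L) + 1`, `t(L)` the tunnel number of the attaching link `L ⊂ S¹ × S²` of the two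
`2`-handles); KNOWN `g = 2` (MSZ Thm. 1.2, `k₁ = g - 1`: the trisection symmetry re-slices `X` into profile
`(1,0,1,1,1)` and Property R closes — tree barrier `Literature.Barriers.SmoothPoincare4.LargeKTrisectionBarrier`),
`g = 3` = the balanced `(3;1,1,1)` = items stmt-SmoothPoincare4-0505/0507 of route `GroupTrisection`
(`GtriCrux2ManifoldV2`), settled when the trisection is weakly reducible or has a dependent triple
(Aranda–Zupan arXiv:2503.04607 Thm. 1.3/1.4, Cor. 1.5) and predicted by Meier's genus-three conjecture
(arXiv:1708.01214 Conj. 1.1); `g ≥ 4` open below SPC4 (`exotic_trisection_constraints`: an exotic sphere's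
trisections have `g ≥ 3`, all `kᵢ ≤ g - 2`; the `(1, 1, g-2)` family is the slice this stub forbids).
Why it might fail: an exotic twisted double of Mazur manifolds / an exotic `(g;1,g-2,1)`-trisected sphere
(none known; every refutation is an exotic `S⁴`).  Discharge: the proof theorem of item 0435 when it lands
(`exact`). [cite: MeierSchirmerZupan2016, Thm. 1.2 and Prop. 4.2] -/
theorem stub_gtriMorse1121 :
    ∀ (M : Type) [TopologicalSpace M] [T2Space M] [SecondCountableTopology M]
      [ChartedSpace (EuclideanSpace ℝ (Fin 4)) M] [IsManifold (𝓡 4) ((⊤ : ℕ∞) : WithTop ℕ∞) M]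
      [CompactSpace M],
      M ≃ₕ Metric.sphere (0 : EuclideanSpace ℝ (Fin 5)) 1 →
      ∀ f : M → ℝ, Literature.Topology.FourManifolds.IsMorse (𝓡 4) f →
      (Literature.Topology.FourManifolds.criticalSetOfIndex (𝓡 4) f 0).ncard = 1 →
      (Literature.Topology.FourManifolds.criticalSetOfIndex (𝓡 4) f 1).ncard ≤ 1 →
      (Literature.Topology.FourManifolds.criticalSetOfIndex (𝓡 4) f 3).ncard ≤ 1 →
      (Literature.Topology.FourManifolds.criticalSetOfIndex (𝓡 4) f 4).ncard = 1 →
      Nonempty (Diffeomorph (𝓡 4) (𝓡 4) M (Metric.sphere (0 : EuclideanSpace ℝ (Fin 5)) 1)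
        ((⊤ : ℕ∞) : WithTop ℕ∞)) := by
  sorry

/-- **THE BET `stub_homotopySphereOneOneTwoOneOne` (m10 form; since m12 DERIVED, no `sorry` of its own):** a
closed smooth `X ≃ₕ S⁴` with a `(1,1,2,1,1)` Morse function carries a `(1,0,1,1,1)` one.  Proof:
`stub_gtriMorse1121` (item stmt-SmoothPoincare4-0435, case `c₁ = c₃ = 1`) gives `X ≅ S⁴`, and a manifold
diffeomorphic to `S⁴` carries a `(1,0,1,1,1)` function (`oneZeroOneOneOne_of_nonempty_diffeomorph_sphere`, landed
with p108569: the height function with one `(2,3)` birth pair, pulled back).  Conversely the bet gives back the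
`(1,1)` case of 0435 through `stub_closedOneZeroOne` (Property R + Laudenbach–Poénaru), so on this profile the
two statements are equivalent modulo LP + R: the bet IS the open core of stmt-SmoothPoincare4-0435 and is not
filed separately.  Three equivalent readings of the smooth content (m10 docstring, kept): (a) SPC4 for homotopy
`4`-spheres of handle profile `(1,1,2,1,1)`; (b) every twisted double `W₁ ∪_ψ W̄₂` of two Mazur-type
contractible `4`-manifolds along ANY boundary diffeomorphism is `S⁴`; (c) every simply connected
`N = S¹ × B³ ∪ h₁ ∪ h₂` with `∂N ≅ S¹ × S²` is `S² × D²`; (d, m12) every homotopy `4`-sphere with a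
`(g; 1, g-2, 1)`-trisection is `S⁴`.  On the crux's Mazur × Mazur sector the `2`-handles are `h_{K₁}` of `W₁`
and `h_γ`, `γ = ψ⁻¹`(belt circle of `W₂`'s `2`-handle); five leads found no contact lever (filling-uniqueness /
Lagrangian-disc / CET levers die on Hayden arXiv:2003.13681 Thm 1.3 and on the exotic Mazur pairs of
Hayden–Mark–Piccirillo arXiv:1908.05269); known instances `ψ = id` (Mazur 1961), zero-dot exchanges inside
`S⁴` (Akbulut 1991; Nersisyan arXiv:2606.24220 §1.2), tunnel number one attaching links (MSZ 2016 Thm 1.2).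
Barrier: `StrictPropertyTwoRBarrier` does NOT bite (one `1`-handle); `LargeKTrisectionBarrier` marks the
solved range `g = 2`. [cite: MeierSchirmerZupan2016, Thm. 1.2] -/
theorem stub_homotopySphereOneOneTwoOneOne :
    ∀ (X : Type) [TopologicalSpace X] [T2Space X] [SecondCountableTopology X] [CompactSpace X]
      [ChartedSpace (EuclideanSpace ℝ (Fin 4)) X] [IsManifold (𝓡 4) ∞ X],
      X ≃ₕ Metric.sphere (0 : EuclideanSpace ℝ (Fin 5)) 1 →
      ∀ (F : X → ℝ), IsMorse (𝓡 4) F →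
      (criticalSetOfIndex (𝓡 4) F 0).ncard = 1 → (criticalSetOfIndex (𝓡 4) F 1).ncard = 1 →
      (criticalSetOfIndex (𝓡 4) F 2).ncard = 2 → (criticalSetOfIndex (𝓡 4) F 3).ncard = 1 →
      (criticalSetOfIndex (𝓡 4) F 4).ncard = 1 →
        ∃ F' : X → ℝ, IsMorse (𝓡 4) F' ∧
          (criticalSetOfIndex (𝓡 4) F' 0).ncard = 1 ∧ (criticalSetOfIndex (𝓡 4) F' 1).ncard = 0 ∧
          (criticalSetOfIndex (𝓡 4) F' 2).ncard = 1 ∧ (criticalSetOfIndex (𝓡 4) F' 3).ncard = 1 ∧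
          (criticalSetOfIndex (𝓡 4) F' 4).ncard = 1 :=
  fun X _ _ _ _ _ _ hX F hF c0 c1 _ c3 c4 =>
    Summit.SmoothPoincare4.SmoothPoincare4.Theorems.ContractibleTwistedDoubleStandard.PropertyRMazurHalves.oneZeroOneOneOne_of_nonempty_diffeomorph_sphere
      X (stub_gtriMorse1121 X hX F hF c0 c1.le c3.le c4)

/-- **Stub 7 (the residual sector, m9 form; open-problem strength — NOT reached by this line's
lever).**  The crux restricted to bisections whose SEAM IS NOT SIMPLY CONNECTED (`∂W₁` is an integral
homology `3`-sphere, `W₁` being contractible; here its perfect fundamental group is non-trivial — in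
particular neither half is a ball) and whose halves are NOT BOTH smoothly Mazur (an adapted Morse
function, Milnor 1965 Def. 3.1, with indices `≤ 2` and exactly one critical point of each index
`0, 1, 2`, i.e. `S¹ × B³ ∪` one `2`-handle).  So some half needs `≥ 2` one-handles (or a `3`-handle)
in EVERY smooth handle structure: cancelling them is a slide-equivalence problem for a balanced
presentation of the trivial group, and `Literature.Barriers.SmoothPoincare4.StrictPropertyTwoRBarrier`
BITES (the closing module would need printed GPR_k, `k ≥ 2`); the `ψ = id` part alone is standardness
of the presentation spheres `D(W)`, `W` a contractible Stein `2`-handlebody with `≥ 2` one-handles and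
`π₁(∂W) ≠ 1` (`Negative.DoubleBisection.double_standard_of_crux` + Gompf 1998 Thm 1.3), which is the
open core of stmt-SmoothPoincare4-3717 / 4786.  m8 → m9: the hypotheses `¬ ball W₁`, `¬ ball W₂` are
replaced by the single STRONGER `¬ SimplyConnectedSpace (∂W₁)` (a ball half has `∂ = S³`), i.e. the
sector is smaller: every bisection with simply connected seam is now closed by Perelman + Eliashberg +
Cerf.  Recon: `Cruxes/…/NonMazurSectorRecon.md` §3–4 (crux-sized; recommended `promote-stub`).  Why it
might fail: an exotic contact twisted double with many-handled halves (none known; candidates: Gompf's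
infinite-order cork twists `𝕊_{r,s,m,k}`, two `1`-handles, IF Stein-compatible); SPC4-implied.  Honours
`not_crux_without_contractible`, `not_crux_without_cover`. -/
theorem stub_nonSmallSector :
    ∀ (X : Type) [TopologicalSpace X] [T2Space X] [SecondCountableTopology X] [CompactSpace X]
      [ChartedSpace (EuclideanSpace ℝ (Fin 4)) X] [IsManifold (𝓡 4) ∞ X]
      (W₁ : Type) [TopologicalSpace W₁] [ChartedSpace (EuclideanHalfSpace 4) W₁]
      [IsManifold (𝓡∂ 4) ∞ W₁] [CompactSpace W₁] [ContractibleSpace W₁]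
      (W₂ : Type) [TopologicalSpace W₂] [ChartedSpace (EuclideanHalfSpace 4) W₂]
      [IsManifold (𝓡∂ 4) ∞ W₂] [CompactSpace W₂] [ContractibleSpace W₂]
      (J₁ : SteinStructure W₁) (J₂ : SteinStructure W₂) (e₁ : W₁ → X) (e₂ : W₂ → X),
      Manifold.IsSmoothEmbedding (𝓡∂ 4) (𝓡 4) ∞ e₁ → Manifold.IsSmoothEmbedding (𝓡∂ 4) (𝓡 4) ∞ e₂ →
      Set.range e₁ ∪ Set.range e₂ = Set.univ →
      Set.range e₁ ∩ Set.range e₂ = e₁ '' (𝓡∂ 4).boundary W₁ →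
      Set.range e₁ ∩ Set.range e₂ = e₂ '' (𝓡∂ 4).boundary W₂ →
      (∀ w₁ w₂, e₁ w₁ = e₂ w₂ →
        Submodule.map (mfderiv (𝓡∂ 4) (𝓡 4) e₁ w₁).toLinearMap (contactPlane J₁.J w₁) =
          Submodule.map (mfderiv (𝓡∂ 4) (𝓡 4) e₂ w₂).toLinearMap (contactPlane J₂.J w₂)) →
      ¬ SimplyConnectedSpace ((𝓡∂ 4).boundary W₁) →
      ¬ ((∃ f : W₁ → ℝ, IsMorseAdapted (𝓡∂ 4) f ∧
            (∀ z, IsMCriticalPt (𝓡∂ 4) f z → morseIndex (𝓡∂ 4) f z ≤ 2) ∧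
            (criticalSetOfIndex (𝓡∂ 4) f 0).ncard = 1 ∧ (criticalSetOfIndex (𝓡∂ 4) f 1).ncard = 1 ∧
            (criticalSetOfIndex (𝓡∂ 4) f 2).ncard = 1) ∧
          (∃ f : W₂ → ℝ, IsMorseAdapted (𝓡∂ 4) f ∧
            (∀ z, IsMCriticalPt (𝓡∂ 4) f z → morseIndex (𝓡∂ 4) f z ≤ 2) ∧
            (criticalSetOfIndex (𝓡∂ 4) f 0).ncard = 1 ∧ (criticalSetOfIndex (𝓡∂ 4) f 1).ncard = 1 ∧
            (criticalSetOfIndex (𝓡∂ 4) f 2).ncard = 1)) →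
      Nonempty (X ≃ₘ⟮𝓡 4, 𝓡 4⟯ Metric.sphere (0 : EuclideanSpace ℝ (Fin 5)) 1) := by
  sorry

/-- **Composition (kernel-checked, no `sorry` of its own): the crux BY NAME from the registered
stubs and the landed theorems, each used BY NAME.**  Simply connected seam: a boundary datum `b₁` of
`W₁` has carrier homeomorphic to `∂W₁`, hence compact and simply connected, hence `≅ S³`
(`stub_factPerelman`), and `Theorems.nonempty_diffeomorph_sphere_four_of_steinBisection_of_diffeomorph`
(Eliashberg twice + Cerf, `stub_factEliashberg` + Cerf from LP) gives `X ≅ S⁴`.  Both halves Mazur: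
`stub_mazurGluedProfile` gives a `(1,1,2,1,1)` function, `stub_homotopySphere` makes `X` a homotopy
`4`-sphere, the bet `stub_homotopySphereOneOneTwoOneOne` (derived from `stub_gtriMorse1121` = item 0435) gives a `(1,0,1,1,1)` function,
`stub_bisectionOrientable` the orientation, and `stub_closedOneZeroOne` (LP, R) closes.  Everything
else is the residual `stub_nonSmallSector`.  Named facts used: P, E, LP, R; open inputs: item 0435, residual. -/
theorem ContractibleTwistedDoubleStandard_of :
    Summit.SmoothPoincare4.SmoothPoincare4.Theses.ConvexBisection.ContractibleTwistedDoubleStandard := by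
  intro X _ _ _ _ _ _ W₁ _ _ _ _ _ W₂ _ _ _ _ _ J₁ J₂ e₁ e₂ h1 h2 hcov hL hR hC
  have hLR := stub_factPropertyRClosingPair
  by_cases hsc : SimplyConnectedSpace ((𝓡∂ 4).boundary W₁)
  · -- simply connected seam: Perelman, Eliashberg (twice), Cerf (from LP)
    have hCerf : cerf_twistedSphere_four :=
      cerf_twistedSphere_four_of_extends''
        (cerf_diffeomorph_sphere_three_extends_ball_of_exists_diffeomorph_comp_incl_eq hLR.1)
    haveI : T2Space W₁ := h1.isEmbedding.t2Space
    haveI : SecondCountableTopology W₁ := h1.isEmbedding.secondCountableTopology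
    obtain ⟨b₁⟩ : Nonempty (BoundaryData (𝓡∂ 4) W₁ (𝓡 3)) := nonempty_boundaryData_holds 3 W₁
    have θ₁ : b₁.carrier ≃ₜ ((𝓡∂ 4).boundary W₁) :=
      b₁.isSmoothEmbedding.isEmbedding.toHomeomorph.trans (Homeomorph.setCongr b₁.range_incl)
    haveI : T2Space b₁.carrier := b₁.isSmoothEmbedding.isEmbedding.t2Space
    haveI : SecondCountableTopology b₁.carrier :=
      b₁.isSmoothEmbedding.isEmbedding.secondCountableTopology
    haveI : CompactSpace ((𝓡∂ 4).boundary W₁) :=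
      isCompact_iff_compactSpace.1 (ModelWithCorners.isClosed_boundary (I := 𝓡∂ 4) (M := W₁)
        (n := ∞) (by simp)).isCompact
    haveI : CompactSpace b₁.carrier := θ₁.symm.compactSpace
    haveI : SimplyConnectedSpace b₁.carrier := θ₁.toHomotopyEquiv.simplyConnectedSpace
    obtain ⟨Θ₁⟩ := stub_factPerelman b₁.carrier
    exact Summit.SmoothPoincare4.SmoothPoincare4.Theorems.nonempty_diffeomorph_sphere_four_of_steinBisection_of_diffeomorph
      stub_factEliashberg hCerf X W₁ W₂ J₁ J₂ e₁ e₂ h1 h2 hcov hL hR b₁ Θ₁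
  by_cases hm : (∃ f : W₁ → ℝ, IsMorseAdapted (𝓡∂ 4) f ∧
        (∀ z, IsMCriticalPt (𝓡∂ 4) f z → morseIndex (𝓡∂ 4) f z ≤ 2) ∧
        (criticalSetOfIndex (𝓡∂ 4) f 0).ncard = 1 ∧ (criticalSetOfIndex (𝓡∂ 4) f 1).ncard = 1 ∧
        (criticalSetOfIndex (𝓡∂ 4) f 2).ncard = 1) ∧
      (∃ f : W₂ → ℝ, IsMorseAdapted (𝓡∂ 4) f ∧
        (∀ z, IsMCriticalPt (𝓡∂ 4) f z → morseIndex (𝓡∂ 4) f z ≤ 2) ∧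
        (criticalSetOfIndex (𝓡∂ 4) f 0).ncard = 1 ∧ (criticalSetOfIndex (𝓡∂ 4) f 1).ncard = 1 ∧
        (criticalSetOfIndex (𝓡∂ 4) f 2).ncard = 1)
  · -- both halves smoothly Mazur: glued `(1,1,2,1,1)` function, homotopy sphere, the bet, the orientation, the closing
    obtain ⟨⟨f₁, hf₁, hi1, h01, h11, h21⟩, ⟨f₂, hf₂, hi2, h02, h12, h22⟩⟩ := hm
    obtain ⟨F, hF, c0, c1, c2, c3, c4⟩ :=
      Summit.SmoothPoincare4.SmoothPoincare4.Theorems.ContractibleTwistedDoubleStandard.PropertyRMazurHalves.stub_mazurGluedProfile X W₁ W₂ J₁ J₂ e₁ e₂ h1 h2 hcov hL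
        hR hC f₁ hf₁ hi1 h01 h11 h21
        f₂ hf₂ hi2 h02 h12 h22
    obtain ⟨hX⟩ :=
      Summit.SmoothPoincare4.SmoothPoincare4.Theorems.ContractibleTwistedDoubleStandard.PropertyRMazurHalves.stub_homotopySphere X W₁ W₂ J₁ J₂ e₁ e₂ h1 h2
        hcov hL hR hC
    obtain ⟨F', hF', c0', c1', c2', c3', c4'⟩ :=
      stub_homotopySphereOneOneTwoOneOne X hX F hF c0 c1 c2 c3 c4
    have hXo : IsOrientable (𝓡 4) X :=
      Summit.SmoothPoincare4.SmoothPoincare4.Theorems.ContractibleTwistedDoubleStandard.PropertyRMazurHalves.stub_bisectionOrientable X W₁ W₂ J₁ J₂ e₁ e₂ h1 h2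
        hcov hL hR hC
    exact Summit.SmoothPoincare4.SmoothPoincare4.Theorems.ContractibleTwistedDoubleStandard.PropertyRMazurHalves.stub_closedOneZeroOne hLR.1 hLR.2 X hXo F' hF'
      c0' c1' c2' c3' c4'
  · exact stub_nonSmallSector X W₁ W₂ J₁ J₂ e₁ e₂ h1 h2 hcov hL hR hC hsc hm

end Summit.SmoothPoincare4.SmoothPoincare4.Cruxes.ContractibleTwistedDoubleStandard.PropertyRMazurHalves

end

-- h21 skeleton audit (reshape m12b): composition concludes the crux by name; sorries only in the stubs;
-- registered via `ledger skeleton check`: stubs stub_factPropertyRClosingPair stub_factEliashberg stub_factPerelman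
-- stub_gtriMorse1121 (= item stmt-SmoothPoincare4-0435 verbatim; THE BET is derived from it) stub_nonSmallSector (residual);
-- IMPORTED (landed, used by name): stub_closedOneZeroOne p108247, stub_bisectionOrientable p108569, stub_mazurGluedProfile p110167,
-- stub_homotopySphere p112822
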